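import Summits.CriticalPhenomena.PercolationContinuityZ3.Theorems.PercNearOneGluingNoHeavyLowerTailQ44WeightedCount

/-!
# `Q44` for all `n`: reduction to the CLICK-UNION COUNT

Support file for crux `stmt-CriticalPhenomena-4575` (master-family programme, quadratic four-point row `Q44`), seat `prim-bnk-1`
gen 22; memo `run/shared/lean/prim/prim-l12/FROM-prim-bnk-1-gen22-CLICK-TRANSPORT.md` §3–§4.

`…Q44WeightedCount` reduced `Q44` (all `n`, all weights) to Conjecture W = `GoodKernel kerQ44`: for every monotone cell map `ι`
on the subsets of a finite type, `#B1-points + #darts ≤ 2·#goods`, goods = `{T : ι T ∈ AC, ι Tᶜ = ⊥}`.  This file records the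
sharper form found in gen 22.  Two subsets `X, Y` CLICK when every cell above `ι X` and `ι Y` is an AC cell and every cell below
`ι Xᶜ` and `ι Yᶜ` is `⊥` (the predicates `upAC`, `downBot` of `…NineTypeLabelCert`); then `X ∪ Y` is a good for every monotone `ι`
(`clickUnion_good`) — a TYPE-FORCED good.  The **click count** `ClickCount B D` asks that the number of distinct click unions alone
already pays for the members: `#B1 + #darts ≤ 2·#{X ∪ Y : X, Y click}`.  Results:

* `TwoCopyMono.clickUnions_subset_goods` — click unions are goods;
* `TwoCopyMono.goodKernel_kerQ44_of_clickCount` — `ClickCount q44B1 q44Darts → GoodKernel kerQ44`;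
* `TwoCopyMono.q44_cells_of_clickCount` — `ClickCount q44B1 q44Darts → Q44 ≥ 0` on every finite weighted graph, all `n`.

Why this is the right target (memo §3): restricting further to `X, Y` that are SIDES of member points, the count is hereditary
under passing to sub-families of points, so it is equivalent to Hall's condition for the capacity-2 transport of gen 21 (H⁺) on
type-forced goods; that sharper count holds for all 70 807 209 monotone maps of `B_4`, for all 59 033 graph fibres with
≤ 6 edges on ≤ 5 vertices or sampled with ≤ 8 edges, for 3·10⁵ random fibres with ≤ 14 edges, and exhaustively in the abstract
typed-set-system model of the memo (§4) for ground sets of size ≤ 5 (27 718 656 configurations); `GoodKernel kerQ44` itself is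
verified for all monotone maps of `B_5` (SAT, kit j145027).  For `K5` points alone the count is the Marica–Schönheim inequality.  No sorries, no named facts, standard axioms; `ClickCount` is the
open combinatorial statement (a hypothesis here, exactly as `GoodKernel kerQ44` is in `…Q44WeightedCount`).
-/

namespace Summit.CriticalPhenomena.PercolationContinuityZ3.Theorems

namespace TwoCopyMono

open Finset FourPointAtoms

variable {γ : Type} [Fintype γ] [DecidableEq γ]

/-! ## Click unions -/

/-- `X` and `Y` CLICK under `ι` (Boolean): every cell above `ι X` and `ι Y` is an AC cell, and every cell below `ι Xᶜ` and
`ι Yᶜ` is `⊥`. [this work] -/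
def click (ι : Finset γ → Fin 15) (X Y : Finset γ) : Bool :=
  upAC (ι X) (ι Y) && downBot (ι Xᶜ) (ι Yᶜ)

/-- The family of CLICK UNIONS `{X ∪ Y : X, Y click}` of a cell map. [this work] -/
def clickUnions (ι : Finset γ → Fin 15) : Finset (Finset γ) :=
  ((Finset.univ ×ˢ Finset.univ).filter fun p : Finset γ × Finset γ => click ι p.1 p.2 = true).image fun p => p.1 ∪ p.2

/-- **A click union is a good** (for every monotone cell map): `ι (X ∪ Y)` is an AC cell and `ι (X ∪ Y)ᶜ = ⊥`. [this work] -/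
theorem clickUnion_good (ι : Finset γ → Fin 15) (hmono : ∀ A B : Finset γ, A ⊆ B → ple (ι A) (ι B) = true)
    {X Y : Finset γ} (h : click ι X Y = true) : isAC (ι (X ∪ Y)) ∧ ι (X ∪ Y)ᶜ = 0 := by
  unfold click at h
  rw [Bool.and_eq_true] at h
  obtain ⟨hup, hdown⟩ := h
  unfold upAC at hup
  unfold downBot at hdown
  have hup' := of_decide_eq_true hup
  have hdown' := of_decide_eq_true hdown
  refine ⟨hup' _ (hmono X (X ∪ Y) Finset.subset_union_left) (hmono Y (X ∪ Y) Finset.subset_union_right), ?_⟩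
  refine hdown' _ (hmono (X ∪ Y)ᶜ Xᶜ ?_) (hmono (X ∪ Y)ᶜ Yᶜ ?_)
  · exact Finset.compl_subset_compl.2 Finset.subset_union_left
  · exact Finset.compl_subset_compl.2 Finset.subset_union_right

/-- Click unions are goods. [this work] -/
theorem clickUnions_subset_goods (ι : Finset γ → Fin 15) (hmono : ∀ A B : Finset γ, A ⊆ B → ple (ι A) (ι B) = true) :
    clickUnions ι ⊆ Finset.univ.filter fun T => isAC (ι T) ∧ ι Tᶜ = 0 := by
  intro T hT
  unfold clickUnions at hT
  rw [Finset.mem_image] at hT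
  obtain ⟨p, hp, rfl⟩ := hT
  rw [Finset.mem_filter] at hp
  rw [Finset.mem_filter]
  exact ⟨Finset.mem_univ _, clickUnion_good ι hmono hp.2⟩

/-! ## The click count and the reduction -/

/-- **The click count** for a weight-two point set `B` and a weight-one point set `D` (memo gen 22, (AC₀), weak form): for every
monotone cell map on the subsets of a finite type, the `B`-points and the `D`-points are paid for by the distinct click unions
alone: `#{T : (ι T, ι Tᶜ) ∈ B} + #{T : (ι T, ι Tᶜ) ∈ D} ≤ 2 · #clickUnions ι`.  The case of interest is `B = q44B1`, `D = q44Darts`.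
[this work] -/
structure ClickCount (B D : Finset (Fin 15 × Fin 15)) : Prop where
  /-- the weighted member count is at most twice the number of click unions -/
  le : ∀ (γ : Type) [Fintype γ] [DecidableEq γ] (ι : Finset γ → Fin 15),
    (∀ A B : Finset γ, A ⊆ B → ple (ι A) (ι B) = true) →
      #(Finset.univ.filter fun T => (ι T, ι Tᶜ) ∈ B) + #(Finset.univ.filter fun T => (ι T, ι Tᶜ) ∈ D) ≤
        2 * #(clickUnions ι)

/-- **The click count implies Conjecture W** (`GoodKernel kerQ44`). [this work] -/
theorem goodKernel_kerQ44_of_clickCount (h : ClickCount q44B1 q44Darts) : GoodKernel kerQ44 := by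
  rw [goodKernel_kerQ44_iff_weightedCount]
  intro γ _ _ ι hmono
  exact (h.le γ ι hmono).trans (Nat.mul_le_mul_left 2 (Finset.card_le_card (clickUnions_subset_goods ι hmono)))

/-- **`Q44` for all `n` from the click count**: if `ClickCount` holds then on every finite weighted graph, for all marked
points, `2·B1 + D ≤ 2[P(ab|cy)+P(abcy)]·P(a|b|c|y)`. [this work] -/
theorem q44_cells_of_clickCount (h : ClickCount q44B1 q44Darts) {n : ℕ} (w : Sym2 (Fin n) → unitInterval) (a b c y : Fin n) :
    2 * (cell w a b c y 11 * cell w a b c y 9 + cell w a b c y 11 * cell w a b c y 8 + cell w a b c y 6 * cell w a b c y 8 +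
        cell w a b c y 6 * cell w a b c y 1 + cell w a b c y 1 * cell w a b c y 8) +
      (cell w a b c y 2 * cell w a b c y 13 + cell w a b c y 1 * cell w a b c y 13 + cell w a b c y 5 * cell w a b c y 12 +
        cell w a b c y 1 * cell w a b c y 12 + cell w a b c y 6 * cell w a b c y 10 + cell w a b c y 6 * cell w a b c y 7 +
        cell w a b c y 2 * cell w a b c y 10 + cell w a b c y 5 * cell w a b c y 7) ≤
      2 * ((cell w a b c y 11 + cell w a b c y 14) * cell w a b c y 0) :=
  q44_cells_of_goodKernel (goodKernel_kerQ44_of_clickCount h) w a b c y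

/-- Sanity: two sides with the SAME cell and reversed co-cell pattern click — e.g. the complement of a `K5` ab-side clicks with
any `K5` ab-side (`cy ∨ ab ∈ AC`, `ab ∧ cy = ⊥`), the Marica–Schönheim case of the memo (§5a). [this work] -/
theorem click_sameCell_K5 : (upAC 1 6 && downBot 6 1) = true := by decide

end TwoCopyMono

end Summit.CriticalPhenomena.PercolationContinuityZ3.Theorems
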